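import Literature.AlgebraicGeometry.Motives.FiniteQuotientQuasiProjective
import Literature.AlgebraicGeometry.Motives.FiniteQuotientClosedImmersion
import HarnessLib

/-!
# Descending an equivariant closed immersion through an ABSTRACT separated quotient of the source
# (Mumford, *Abelian Varieties*, §7 Thm. p. 66 (Remark); Mumford–Fogarty–Kirwan, GIT, Ch. 1 §2, proof of Thm. 1.1 (3))

Topic `AlgebraicGeometry/Motives`; namespace `Literature.AlgebraicGeometry.Motives`. The «descent package» consumed by the I-1′
receptacle (cell `hodgecm-mathlib`, crux `HDel`, stub `stub_Squot`, RECEPTACLE-PLAN §7.2 Step D): let a finite group `Δ` with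
`|Δ| ≠ 0` in the field `k` act by `k`-automorphisms on separated `k`-schemes `Y`, `Z` whose `Δ`-stable affine opens cover them,
let `q : Y ⟶ Y'` be ANY quotient of `Y` for separated test objects (`Motives.IsSepQuotient`, `Y'` separated — e.g. a level-change map
of a Shimura tower, which is not syntactically the tree's `finiteQuotient`), and let `f : Y ⟶ Z` be a `Δ`-EQUIVARIANT `k`-morphism
whose underlying morphism is a closed immersion. Then `f` descends along `q` to a CLOSED IMMERSION `f̄ : Y' ⟶ Z/Δ` into the tree's
finite quotient of `Z` with `q ≫ f̄ = f ≫ π_Z` (`exists_isClosedImmersion_desc_of_isSepQuotient`), unique (`IsSepQuotient.hom_ext`).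
Proof: `Y' ≅ Y/Δ` under `Y` (`isoFiniteQuotient_of_isSepQuotient_of_cover`, `Motives/FiniteQuotientQuasiProjective`), the induced
`Y/Δ ⟶ Z/Δ` is a closed immersion (`isClosedImmersion_finiteQuotientDesc_left`, `Motives/FiniteQuotientClosedImmersion`), and closed
immersions are stable under composition with isomorphisms. Everything is proved; no definitions, no named facts.

## References
* [MumfordAV1970] D. Mumford, *Abelian Varieties* (1970), §7 Thm. p. 66 and Remark (categorical quotient).
* [MumfordFogartyKirwan1994] D. Mumford, J. Fogarty, F. Kirwan, *Geometric Invariant Theory* (1994), Ch. 1 §2, proof of Thm. 1.1, (3).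
-/

noncomputable section

open CategoryTheory CategoryTheory.Limits AlgebraicGeometry
open Literature.AlgebraicGeometry.RelativeSpec

universe u

namespace Literature.AlgebraicGeometry.Motives

variable {k : Type u} [Field k] {Δ : Type} [Group Δ] [Finite Δ] {Y Y' Z : SchemeOver k}
  [IsSeparated Y.hom] [IsSeparated Z.hom]

set_option backward.isDefEq.respectTransparency false

/-- A `k`-scheme with separated structure map is a separated scheme. [folklore] -/
private theorem isSeparated_left_of_isSeparated_hom'' (W : SchemeOver k) (hW : IsSeparated W.hom) :
    W.left.IsSeparated :=
  ⟨by rw [← terminal.comp_from W.hom]; infer_instance⟩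

/-- **Descent of an equivariant closed immersion through an abstract separated quotient of the source.** `Δ` finite with
`|Δ| ≠ 0` in `k`, acting by `k`-automorphisms `actY`, `actZ` on separated `k`-schemes `Y`, `Z` whose `Δ`-stable affine opens cover
them; `q : Y ⟶ Y'` a quotient of `Y` for separated test objects with `Y'` separated; `f : Y ⟶ Z` equivariant with `f.left` a closed
immersion. Then there is `f̄ : Y' ⟶ Z/Δ` (the tree's `finiteQuotient` of `Z`) with `q ≫ f̄ = f ≫ π_Z` and `f̄.left` a CLOSED IMMERSION
(`Y' ≅ Y/Δ` under `Y`; `Y/Δ ⟶ Z/Δ` is a closed immersion by the Reynolds operator; compose). The factorisation is unique by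
`IsSepQuotient.hom_ext`. [cite: MumfordAV1970, §7 Thm. p. 66 (Remark)] [cite: MumfordFogartyKirwan1994, Ch. 1 §2, proof of Thm. 1.1, statement (3)] -/
theorem exists_isClosedImmersion_desc_of_isSepQuotient (actY : Δ →* Aut Y) (actZ : Δ →* Aut Z)
    (hcovY : ∀ y : Y.left, ∃ O : (⟨((Over.forget _).mapAut Y).comp actY, fun g => Over.w (actY g).hom⟩ :
        ActionOver Y.hom Δ).StableAffineOpens, y ∈ O.1)
    (hcovZ : ∀ z : Z.left, ∃ O : (⟨((Over.forget _).mapAut Z).comp actZ, fun g => Over.w (actZ g).hom⟩ :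
        ActionOver Z.hom Δ).StableAffineOpens, z ∈ O.1)
    (q : Y ⟶ Y') (hq : IsSepQuotient (fun g => actY g) q) (hY' : IsSeparated Y'.hom)
    (f : Y ⟶ Z) [IsClosedImmersion f.left] (hf : ∀ g : Δ, f ≫ (actZ g).hom = (actY g).hom ≫ f)
    (hk : (Nat.card Δ : k) ≠ 0) :
    ∃ fbar : Y' ⟶ finiteQuotient (⟨((Over.forget _).mapAut Z).comp actZ, fun g => Over.w (actZ g).hom⟩ :
        ActionOver Z.hom Δ),
      q ≫ fbar = f ≫ finiteQuotient.mk _ hcovZ ∧ IsClosedImmersion fbar.left := by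
  let ρY : ActionOver Y.hom Δ := ⟨((Over.forget _).mapAut Y).comp actY, fun g => Over.w (actY g).hom⟩
  let ρZ : ActionOver Z.hom Δ := ⟨((Over.forget _).mapAut Z).comp actZ, fun g => Over.w (actZ g).hom⟩
  haveI : (finiteQuotient ρZ).left.IsSeparated :=
    isSeparated_left_of_isSeparated_hom'' _ (isSeparated_finiteQuotient_hom ρZ hcovZ)
  -- the equivariance in `overIso` form and the induced map of the tree's quotients
  have hov : ∀ (g : Δ), (ρY.overIso g).hom = (actY g).hom := fun g => Over.OverMorphism.ext rfl
  have hovZ : ∀ (g : Δ), (ρZ.overIso g).hom = (actZ g).hom := fun g => Over.OverMorphism.ext rfl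
  have hfo : ∀ g : Δ, f ≫ (ρZ.overIso g).hom = (ρY.overIso g).hom ≫ f := fun g => by
    rw [hov, hovZ]; exact hf g
  have hinv : ∀ g : Δ, (ρY.overIso g).hom ≫ f ≫ finiteQuotient.mk ρZ hcovZ = f ≫ finiteQuotient.mk ρZ hcovZ :=
    fun g => by rw [← Category.assoc, ← hfo g, Category.assoc, finiteQuotient.overIso_hom_mk]
  have hci : IsClosedImmersion (finiteQuotient.desc ρY hcovY (f ≫ finiteQuotient.mk ρZ hcovZ) hinv).left :=
    isClosedImmersion_finiteQuotientDesc_left ρY ρZ hcovY hcovZ f hk hfo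
  -- `Y' ≅ Y/Δ` under `Y`
  obtain ⟨i, hi⟩ := isoFiniteQuotient_of_isSepQuotient_of_cover actY hcovY q hY' hq
  refine ⟨i.hom ≫ finiteQuotient.desc ρY hcovY (f ≫ finiteQuotient.mk ρZ hcovZ) hinv, ?_, ?_⟩
  · rw [← Category.assoc, hi, finiteQuotient.mk_desc]
  · rw [Over.comp_left]
    infer_instance

omit [IsSeparated Y.hom] in
/-- **Uniqueness of the descended morphism** (any two factorisations of `f ≫ π_Z` through the quotient `q` agree, the
target `Z/Δ` being separated). [cite: MumfordAV1970, §7 Thm. p. 66 (Remark)] -/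
theorem desc_unique_of_isSepQuotient (actY : Δ →* Aut Y) (actZ : Δ →* Aut Z)
    (hcovZ : ∀ z : Z.left, ∃ O : (⟨((Over.forget _).mapAut Z).comp actZ, fun g => Over.w (actZ g).hom⟩ :
        ActionOver Z.hom Δ).StableAffineOpens, z ∈ O.1)
    (q : Y ⟶ Y') (hq : IsSepQuotient (fun g => actY g) q) (f : Y ⟶ Z)
    {a b : Y' ⟶ finiteQuotient (⟨((Over.forget _).mapAut Z).comp actZ, fun g => Over.w (actZ g).hom⟩ :
        ActionOver Z.hom Δ)}
    (ha : q ≫ a = f ≫ finiteQuotient.mk _ hcovZ) (hb : q ≫ b = f ≫ finiteQuotient.mk _ hcovZ) : a = b :=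
  hq.hom_ext (isSeparated_finiteQuotient_hom _ hcovZ) (ha.trans hb.symm)

end Literature.AlgebraicGeometry.Motives

end
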